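import Summits.Parity.BatemanHorn.Theorems.SoloInformedConjEIffLargeDivisors

/-!
# SoloInformedLogPowerCut — Conjecture E lives in the divisors `d > x/(log x)^A` of `n² + 1` (any `A > 1`)

Solo unit `solo-Parity-informed` (ideation tier, informed mode), session 8; `PLAN.md` §15.3/§16.4(a), CLAIMS C39.

`SoloInformedConjEIffLargeDivisors` places Hardy–Littlewood's Conjecture E in the Möbius–log sum over the divisor
pairs `(n, d)`, `d ∣ n² + 1`, `d > x^{1-ε}`.  The cut `x^{1-ε}` was dictated by the divisor-bound bookkeeping of the
three-range schema, not by the mathematics: the small-divisor remainder `∑_{d ≤ y} μ(d) log d · rem(x; d)` is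
`≤ log y · ∑_{d ≤ y} ρ(d) ≤ C y log y` by the mean value `∑_{m ≤ y} ρ(m) ≤ C y` (Iwaniec 1978 §4, tree:
`Iwaniec1978.exists_sum_rho_le`), so EVERY cut `y(x) → ∞` with `y log y = o(x)` is admissible.  This file proves the
equivalence for an abstract admissible cut and specialises it to the largest natural one, `y = ⌊x/(log x)^A⌋`, `A > 1`:

* `abs_sum_moebius_log_rem_le` — `|∑_{d ≤ D} μ(d) log d · rem(x; d)| ≤ log D · C D`;
* `mainError_isLittleO_of_cut`, `isEquivalent_sum_vonMangoldt_iff_largeDivisorSum_isLittleO_of_cut` — for any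
  `y : ℕ → ℕ` with `y → ∞` and `y log y = o(x)`:  `ψ_{n²+1}(x) ~ 𝔖 x ⟺ T(x; y(x)) = o(x)`;
* `tendsto_logPowCut_atTop`, `logPowCut_mul_log_isLittleO` — `⌊x/(log x)^A⌋` is admissible for `A > 1`;
* `hardyLittlewoodConjE_iff_largeDivisorSum_isLittleO_logPowCut` — for every `A > 1`,
    HardyLittlewoodConjE  ⟺  `∑_{n ≤ x} ∑_{d ∣ n²+1, d > ⌊x/(log x)^A⌋} μ(d) log d = o(x)`.

So all of Conjecture E sits in the divisors `d` of the numbers `n² + 1 ≤ x² + 1` lying within a power of `log x` below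
`x` and above — in Gaussian terms, in the factorisations `n + i = u·αβ` with `N(β) = (n²+1)/d < (x² + 1)(log x)^A/x`.
(The trivial bound for the right-hand side is `T ≪ x (log x)²`; the conjecture asks for `o(x)`.)  No bearing on the truth
of the conjecture.
-/

namespace Summit.Parity.BatemanHorn.Theorems

open Finset Filter ArithmeticFunction Asymptotics
open scoped ArithmeticFunction.Moebius Topology
open Literature.NumberTheory.Sieve (hardyLittlewoodEConst hardyLittlewoodEConst_pos HardyLittlewoodConjE)
open Literature.NumberTheory.Sieve.Iwaniec1978 (rho rem abs_rem_le_rho exists_sum_rho_le)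

/-! ### The small-divisor remainder at an arbitrary level -/

/-- `|∑_{d ≤ D} μ(d) log d · rem(x; d)| ≤ log D · (C D)` whenever `∑_{m ≤ y} ρ(m) ≤ C y` (`y ≥ 2`) and `D ≥ 2`
(`|μ| ≤ 1`, `0 ≤ log d ≤ log D`, `|rem(x; d)| ≤ ρ(d)`). -/
theorem abs_sum_moebius_log_rem_le {C : ℝ}
    (hC : ∀ y : ℝ, 2 ≤ y → ∑ m ∈ Icc 1 ⌊y⌋₊, (rho m : ℝ) ≤ C * y) (x : ℕ) {D : ℕ} (hD : 2 ≤ D) :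
    |∑ d ∈ Icc 1 D, (μ d : ℝ) * Real.log d * rem (x : ℝ) d| ≤ Real.log D * (C * D) := by
  have hsum : ∑ m ∈ Icc 1 D, (rho m : ℝ) ≤ C * D := by
    have h := hC D (by exact_mod_cast hD)
    rwa [Nat.floor_natCast] at h
  have hlogD0 : 0 ≤ Real.log (D : ℝ) := Real.log_natCast_nonneg D
  calc |∑ d ∈ Icc 1 D, (μ d : ℝ) * Real.log d * rem (x : ℝ) d|
      ≤ ∑ d ∈ Icc 1 D, |(μ d : ℝ) * Real.log d * rem (x : ℝ) d| := abs_sum_le_sum_abs _ _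
    _ ≤ ∑ d ∈ Icc 1 D, Real.log D * (rho d : ℝ) := by
        refine sum_le_sum fun d hd => ?_
        have hd1 : 1 ≤ d := (mem_Icc.mp hd).1
        have hdD : d ≤ D := (mem_Icc.mp hd).2
        have hμ : |(μ d : ℝ)| ≤ 1 := by exact_mod_cast abs_moebius_le_one
        have hlog0 : 0 ≤ Real.log (d : ℝ) := Real.log_natCast_nonneg d
        have hlogD : Real.log (d : ℝ) ≤ Real.log D :=
          Real.log_le_log (by positivity) (by exact_mod_cast hdD)
        have hrem : |rem (x : ℝ) d| ≤ rho d := abs_rem_le_rho (Nat.cast_nonneg x) (by omega)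
        rw [abs_mul, abs_mul, abs_of_nonneg hlog0]
        calc |(μ d : ℝ)| * Real.log d * |rem (x : ℝ) d| ≤ 1 * Real.log D * rho d :=
              mul_le_mul (mul_le_mul hμ hlogD hlog0 zero_le_one) hrem (abs_nonneg _) (by positivity)
          _ = Real.log D * rho d := by ring
    _ = Real.log D * ∑ d ∈ Icc 1 D, (rho d : ℝ) := (mul_sum _ _ _).symm
    _ ≤ Real.log D * (C * D) := mul_le_mul_of_nonneg_left hsum hlogD0

/-! ### The equivalence at an abstract admissible cut -/

/-- The error `x · (M(y(x)) - 𝔖) - ∑_{d ≤ y(x)} μ(d) log d · rem(x; d)` is `o(x)` for every cut `y → ∞` with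
`y log y = o(x)` (uses `(R1)`, now the theorem `tendsto_neg_sum_moebius_log_rho_div`). -/
theorem mainError_isLittleO_of_cut {y : ℕ → ℕ} (hy : Tendsto y atTop atTop)
    (hy' : (fun x : ℕ => Real.log (y x) * (y x : ℝ)) =o[atTop] fun x : ℕ => (x : ℝ)) :
    (fun x : ℕ => (x : ℝ) * ((-∑ d ∈ Icc 1 (y x), (μ d : ℝ) * Real.log d * rho d / d)
          - hardyLittlewoodEConst)
        - ∑ d ∈ Icc 1 (y x), (μ d : ℝ) * Real.log d * rem (x : ℝ) d)
      =o[atTop] fun x : ℕ => (x : ℝ) := by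
  obtain ⟨C, hC0, hC⟩ := exists_sum_rho_le
  rw [isLittleO_iff]
  intro c hc
  have h1 : ∀ᶠ x : ℕ in atTop,
      |(-∑ d ∈ Icc 1 (y x), (μ d : ℝ) * Real.log d * rho d / d) - hardyLittlewoodEConst| ≤ c / 2 := by
    have hev := hy.eventually
      (Metric.tendsto_nhds.mp tendsto_neg_sum_moebius_log_rho_div (c / 2) (by positivity))
    filter_upwards [hev] with x hx
    rw [Real.dist_eq] at hx
    exact hx.le
  have h2 : ∀ᶠ x : ℕ in atTop, Real.log (y x) * (C * (y x : ℝ)) ≤ c / 2 * x := by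
    have h := hy'.bound (show (0 : ℝ) < c / 2 / C by positivity)
    filter_upwards [h] with x hx
    rw [Real.norm_eq_abs, Real.norm_eq_abs,
      abs_of_nonneg (mul_nonneg (Real.log_natCast_nonneg _) (Nat.cast_nonneg _)),
      abs_of_nonneg (Nat.cast_nonneg x)] at hx
    calc Real.log (y x) * (C * (y x : ℝ)) = C * (Real.log (y x) * (y x : ℝ)) := by ring
      _ ≤ C * (c / 2 / C * x) := mul_le_mul_of_nonneg_left hx hC0.le
      _ = c / 2 * x := by field_simp
  filter_upwards [h1, h2, hy.eventually_ge_atTop 2, eventually_ge_atTop 1] with x hx1 hx2 hy2 hx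
  have hx0 : (0 : ℝ) ≤ x := by positivity
  have hrem : |∑ d ∈ Icc 1 (y x), (μ d : ℝ) * Real.log d * rem (x : ℝ) d| ≤ c / 2 * x :=
    (abs_sum_moebius_log_rem_le hC x hy2).trans hx2
  have hmain : |(x : ℝ) * ((-∑ d ∈ Icc 1 (y x), (μ d : ℝ) * Real.log d * rho d / d)
      - hardyLittlewoodEConst)| ≤ x * (c / 2) := by
    rw [abs_mul, abs_of_nonneg hx0]
    exact mul_le_mul_of_nonneg_left hx1 hx0
  simp only [Real.norm_eq_abs]
  rw [abs_of_nonneg hx0]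
  calc _ ≤ |(x : ℝ) * ((-∑ d ∈ Icc 1 (y x), (μ d : ℝ) * Real.log d * rho d / d)
            - hardyLittlewoodEConst)|
          + |∑ d ∈ Icc 1 (y x), (μ d : ℝ) * Real.log d * rem (x : ℝ) d| := abs_sub _ _
    _ ≤ x * (c / 2) + c / 2 * x := add_le_add hmain hrem
    _ = c * x := by ring

/-- **`ψ_{n²+1}(x) ~ 𝔖 x ⟺ T(x; y(x)) = o(x)` for every admissible cut** `y → ∞`, `y log y = o(x)`. -/
theorem isEquivalent_sum_vonMangoldt_iff_largeDivisorSum_isLittleO_of_cut {y : ℕ → ℕ}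
    (hy : Tendsto y atTop atTop)
    (hy' : (fun x : ℕ => Real.log (y x) * (y x : ℝ)) =o[atTop] fun x : ℕ => (x : ℝ)) :
    ((fun x : ℕ => ∑ n ∈ Icc 1 x, Λ (n ^ 2 + 1)) ~[atTop]
        fun x : ℕ => hardyLittlewoodEConst * (x : ℝ))
      ↔ (fun x : ℕ => ∑ n ∈ Icc 1 x, ∑ e ∈ (n ^ 2 + 1).divisors with y x < (n ^ 2 + 1) / e,
            (μ ((n ^ 2 + 1) / e) : ℝ) * Real.log (((n ^ 2 + 1) / e : ℕ) : ℝ))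
          =o[atTop] fun x : ℕ => (x : ℝ) := by
  have hS : hardyLittlewoodEConst ≠ 0 := hardyLittlewoodEConst_pos.ne'
  have hE := mainError_isLittleO_of_cut hy hy'
  have hid : ((fun x : ℕ => ∑ n ∈ Icc 1 x, Λ (n ^ 2 + 1))
        - fun x : ℕ => hardyLittlewoodEConst * (x : ℝ))
      = fun x : ℕ =>
        ((x : ℝ) * ((-∑ d ∈ Icc 1 (y x), (μ d : ℝ) * Real.log d * rho d / d)
            - hardyLittlewoodEConst)
          - ∑ d ∈ Icc 1 (y x), (μ d : ℝ) * Real.log d * rem (x : ℝ) d)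
        - ∑ n ∈ Icc 1 x, ∑ e ∈ (n ^ 2 + 1).divisors with y x < (n ^ 2 + 1) / e,
            (μ ((n ^ 2 + 1) / e) : ℝ) * Real.log (((n ^ 2 + 1) / e : ℕ) : ℝ) := by
    funext x
    have h := sum_vonMangoldt_sub_add_largeDivisorSum_eq x (y x) hardyLittlewoodEConst
    simp only [Pi.sub_apply]
    linarith
  show ((fun x : ℕ => ∑ n ∈ Icc 1 x, Λ (n ^ 2 + 1)) - fun x : ℕ => hardyLittlewoodEConst * (x : ℝ))
      =o[atTop] (fun x : ℕ => hardyLittlewoodEConst * (x : ℝ)) ↔ _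
  rw [isLittleO_const_mul_right_iff hS, hid]
  constructor
  · intro h
    exact (hE.sub h).congr_left fun x => by ring
  · intro hT
    exact hE.sub hT

/-! ### The cut `⌊x/(log x)^A⌋`, `A > 1` -/

/-- `⌊x/(log x)^A⌋ → ∞` (indeed `x/(log x)^A ≥ x^{1/2}` eventually). -/
theorem tendsto_logPowCut_atTop {A : ℝ} (hA : 0 < A) :
    Tendsto (fun x : ℕ => ⌊(x : ℝ) / Real.log x ^ A⌋₊) atTop atTop := by
  have hlog : ∀ᶠ t : ℝ in atTop, ‖Real.log t‖ ≤ 1 * ‖t ^ (1 / (2 * A))‖ :=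
    (isLittleO_log_rpow_atTop (by positivity : 0 < 1 / (2 * A))).bound one_pos
  have hhalf : Tendsto (fun x : ℕ => ((x : ℝ) ^ (1 / 2 : ℝ))) atTop atTop :=
    (tendsto_rpow_atTop (by norm_num)).comp tendsto_natCast_atTop_atTop
  refine tendsto_nat_floor_atTop.comp (tendsto_atTop_mono' atTop ?_ hhalf)
  filter_upwards [tendsto_natCast_atTop_atTop.eventually hlog, eventually_ge_atTop 3] with x hx hx3
  have hX : (3 : ℝ) ≤ x := by exact_mod_cast hx3
  have hX0 : (0 : ℝ) < x := by linarith
  have hl0 : 0 < Real.log (x : ℝ) := Real.log_pos (by linarith)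
  rw [Real.norm_eq_abs, Real.norm_eq_abs, abs_of_pos hl0, one_mul,
    abs_of_pos (Real.rpow_pos_of_pos hX0 _)] at hx
  have hpow : Real.log (x : ℝ) ^ A ≤ (x : ℝ) ^ (1 / 2 : ℝ) := by
    calc Real.log (x : ℝ) ^ A ≤ ((x : ℝ) ^ (1 / (2 * A))) ^ A :=
          Real.rpow_le_rpow hl0.le hx hA.le
      _ = (x : ℝ) ^ (1 / 2 : ℝ) := by
          rw [← Real.rpow_mul hX0.le]
          congr 1
          field_simp
  have hpow0 : 0 < Real.log (x : ℝ) ^ A := Real.rpow_pos_of_pos hl0 _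
  rw [le_div_iff₀ hpow0]
  calc (x : ℝ) ^ (1 / 2 : ℝ) * Real.log x ^ A ≤ (x : ℝ) ^ (1 / 2 : ℝ) * (x : ℝ) ^ (1 / 2 : ℝ) :=
        mul_le_mul_of_nonneg_left hpow (by positivity)
    _ = x := by
        rw [← Real.rpow_add hX0]
        norm_num

/-- `y log y = o(x)` for `y = ⌊x/(log x)^A⌋`, `A > 1` (indeed `≤ x (log x)^{1-A}`). -/
theorem logPowCut_mul_log_isLittleO {A : ℝ} (hA : 1 < A) :
    (fun x : ℕ => Real.log (⌊(x : ℝ) / Real.log x ^ A⌋₊ : ℕ) * ((⌊(x : ℝ) / Real.log x ^ A⌋₊ : ℕ) : ℝ))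
      =o[atTop] fun x : ℕ => (x : ℝ) := by
  have hlogT : Tendsto (fun x : ℕ => Real.log (x : ℝ)) atTop atTop :=
    Real.tendsto_log_atTop.comp tendsto_natCast_atTop_atTop
  have hdec : Tendsto (fun x : ℕ => Real.log (x : ℝ) ^ (1 - A)) atTop (𝓝 0) := by
    have h := (tendsto_rpow_neg_atTop (by linarith : 0 < A - 1)).comp hlogT
    refine h.congr fun x => ?_
    simp only [Function.comp_apply]
    rw [neg_sub]
  rw [isLittleO_iff]
  intro c hc
  filter_upwards [(Metric.tendsto_nhds.mp hdec) c hc, eventually_ge_atTop 3] with x hx hx3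
  have hX : (3 : ℝ) ≤ x := by exact_mod_cast hx3
  have hX0 : (0 : ℝ) < x := by linarith
  have hl1 : 1 < Real.log (x : ℝ) := by
    have h := Real.exp_one_lt_d9
    rw [Real.lt_log_iff_exp_lt hX0]
    linarith
  have hl0 : 0 < Real.log (x : ℝ) := by linarith
  rw [Real.dist_eq, sub_zero, abs_of_pos (Real.rpow_pos_of_pos hl0 _)] at hx
  have hpow1 : 1 ≤ Real.log (x : ℝ) ^ A := Real.one_le_rpow hl1.le (by linarith)
  set Y : ℕ := ⌊(x : ℝ) / Real.log x ^ A⌋₊ with hY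
  have hYle : (Y : ℝ) ≤ (x : ℝ) / Real.log x ^ A := Nat.floor_le (by positivity)
  have hYx : (Y : ℝ) ≤ x := hYle.trans (div_le_self hX0.le hpow1)
  have hlogY : Real.log (Y : ℝ) ≤ Real.log x := by
    rcases Nat.eq_zero_or_pos Y with hY0 | hY0
    · rw [hY0, Nat.cast_zero, Real.log_zero]; exact hl0.le
    · exact Real.log_le_log (by exact_mod_cast hY0) hYx
  have hlogY0 : 0 ≤ Real.log (Y : ℝ) := Real.log_natCast_nonneg Y
  rw [Real.norm_eq_abs, Real.norm_eq_abs, abs_of_nonneg (mul_nonneg hlogY0 (Nat.cast_nonneg Y)),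
    abs_of_pos hX0]
  calc Real.log (Y : ℝ) * (Y : ℝ) ≤ Real.log x * ((x : ℝ) / Real.log x ^ A) :=
        mul_le_mul hlogY hYle (Nat.cast_nonneg Y) hl0.le
    _ = Real.log (x : ℝ) ^ (1 - A) * x := by
        rw [Real.rpow_sub hl0, Real.rpow_one]
        field_simp
    _ ≤ c * x := mul_le_mul_of_nonneg_right hx.le hX0.le

/-- **Hardy–Littlewood's Conjecture E ⟺ Möbius–log cancellation over the divisors `d > x/(log x)^A`** (any `A > 1`):
`#{n ≤ x : n² + 1 prime} ~ (𝔖/2) x/log x` if and only if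
`∑_{n ≤ x} ∑_{d ∣ n²+1, d > ⌊x/(log x)^A⌋} μ(d) log d = o(x)` (inner sum written over the cofactor `e = (n²+1)/d`). -/
theorem hardyLittlewoodConjE_iff_largeDivisorSum_isLittleO_logPowCut {A : ℝ} (hA : 1 < A) :
    HardyLittlewoodConjE ↔
      (fun x : ℕ => ∑ n ∈ Icc 1 x,
          ∑ e ∈ (n ^ 2 + 1).divisors with ⌊(x : ℝ) / Real.log x ^ A⌋₊ < (n ^ 2 + 1) / e,
            (μ ((n ^ 2 + 1) / e) : ℝ) * Real.log (((n ^ 2 + 1) / e : ℕ) : ℝ))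
        =o[atTop] fun x : ℕ => (x : ℝ) :=
  hardyLittlewoodConjE_iff_isEquivalent_sum_vonMangoldt.trans
    (isEquivalent_sum_vonMangoldt_iff_largeDivisorSum_isLittleO_of_cut
      (tendsto_logPowCut_atTop (by linarith)) (logPowCut_mul_log_isLittleO hA))

end Summit.Parity.BatemanHorn.Theorems
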